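import Mathlib
import HarnessLib
import Summits.Ventures.LatticeQCDFlow.Scoring.TwoCodeAgreementInProbability
import Summits.Ventures.LatticeQCDFlow.Scoring.AsymptoticCoverage
import Summits.Ventures.LatticeQCDFlow.Scoring.AgreementTestPower

/-!
# The POWER FUNCTION of the two-code agreement test under LOCAL alternatives: if the two codes'
# targets differ by `δ` TRUE combined standard errors, the studentised difference tends to
# `N(δ, 1)`, so "within `z·σ_comb`" holds with probability `→ N(δ,1)([−z, z])` — nominal at
# `δ = 0`, at most `1/2` at `δ = z`, and `→ 0` as `δ → ±∞`

HONEST FRAMING: exact (Metropolis-corrected) sampling algorithms for lattice gauge theory;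
figures of merit are autocorrelation/cost numbers at stated couplings and volumes; no
continuum-physics claim.

Venture `LatticeQCDFlow` (cell pub-lqcd), topic `Scoring`; FANOUT row 4 (`s0-u1-b`, rung S0-B:
"A vs B within `1σ_comb`").  `Scoring/AsymptoticCoverage` gave the SIZE of the criterion (two
codes with the same target: probability `→ N(0,1)([−z, z])`) and `Scoring/AgreementTestPower` its
consistency (a FIXED discrepancy is detected with probability `→ 1`), listing the power FUNCTION
under local alternatives as not claimed.  This file supplies it, in the abstract two-code setting
of `Scoring/TwoCodeAgreementInProbability.twoSample_agreement_clt_of_tendstoInMeasure`: code `A`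
prints `Sₙ^A` with `√n (Sₙ^A − a) ⇒ N(0, s_A)`, code `B` prints `Sₙ^B` with
`√n (Sₙ^B − bₙ) ⇒ N(0, s_B)` for a (possibly moving) target `bₙ`, squared standard errors with
`n·V̂ₙ^X → s_X > 0` in probability, code `B` read along any `mₙ → ∞`, the two runs independent.
If the discrepancy measured in TRUE combined standard errors converges,
`δₙ := (a − b_{mₙ}) / √(s_A/n + s_B/mₙ) → δ`, then the studentised difference
`Tₙ = (Sₙ^A − S_{mₙ}^B)/√(V̂ₙ^A + V̂_{mₙ}^B) ⇒ Z + δ ∼ N(δ, 1)` (**`twoSample_agreement_local_clt`**: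
recentre code `B` at `a`, apply the null theorem, and add the deterministic shift divided by the
pooled-variance ratio `→ 1` in probability — Slutsky), hence for every `z`
`P(|Tₙ| ≤ z) → N(δ, 1)([−z, z])` (**`twoSample_agreement_localPower`**).  The limit is read through
three Gaussian facts: `N(δ,1)([−z, z]) = N(0,1)([−z−δ, z−δ])` (**`gaussianReal_real_Icc_shift`**);
it tends to `0` as `δ → +∞` or `δ → −∞` (**`tendsto_gaussianReal_real_Icc_atTop`**, `…_atBot`);
and at `δ = z > 0` it is at most `1/2` (**`gaussianReal_real_Icc_self_le_half`**): a true
discrepancy of exactly `z` combined standard errors passes the "within `z·σ_comb`" criterion at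
most half the time, asymptotically.  NEW WORK of the cell (textbook asymptotics; our
formalisation); no definition; nothing cited as a fact.  Printed counterparts NAMED ONLY: Pitman
local alternatives / the power function of the two-sample z-test (folklore).

## Content

* `gaussianReal_real_Iic_zero` (`N(0,1)(−∞, 0] = 1/2`), **`gaussianReal_real_Icc_shift`**,
  **`gaussianReal_real_Icc_self_le_half`**, **`tendsto_gaussianReal_real_Icc_atTop`**,
  **`tendsto_gaussianReal_real_Icc_atBot`**;
* **`twoSample_agreement_local_clt`**, **`twoSample_agreement_localPower`**.

NOT CLAIMED: rates (Berry–Esseen); random `mₙ`; the chain instances (feed row 8's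
`doeblinPower_arm_clt_and_errorBar` exactly as in `Scoring/DoeblinPowerTwoChainAgreement`); any
number of ours.
-/

noncomputable section

namespace Summit.Ventures.LatticeQCDFlow.Scoring.CardConsistency

open MeasureTheory ProbabilityTheory Filter Set
open scoped Topology ENNReal NNReal

/-! ## §1 Gaussian window probabilities -/

section Gaussian

/-- `N(0,1)((−∞, 0]) = 1/2` (symmetry and no atom at `0`). [folklore] -/
theorem gaussianReal_real_Iic_zero : (gaussianReal 0 1).real (Iic 0) = 1 / 2 := by
  have hsymm : (gaussianReal 0 1) (Ici 0) = (gaussianReal 0 1) (Iic 0) := by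
    have h := gaussianReal_map_neg (μ := 0) (v := 1)
    rw [neg_zero] at h
    have h2 : (gaussianReal 0 1) (Ici 0) = ((gaussianReal 0 1).map (fun x : ℝ => -x)) (Ici 0) := by
      rw [h]
    rw [h2, Measure.map_apply measurable_neg measurableSet_Ici]
    congr 1
    ext x
    simp
  have hunion : (gaussianReal 0 1) (Iic 0) + (gaussianReal 0 1) (Ici 0) = 1 + (gaussianReal 0 1) {0} := by
    rw [← measure_union_add_inter (Iic (0 : ℝ)) measurableSet_Ici, Iic_union_Ici, measure_univ,
      Set.inter_comm, Ici_inter_Iic, Icc_self]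
  haveI := nullSingletonClass_gaussianReal (μ := 0) one_ne_zero
  rw [measure_singleton, add_zero, hsymm] at hunion
  have hne : (gaussianReal 0 1) (Iic 0) ≠ ∞ := measure_ne_top _ _
  have h2 : 2 * ((gaussianReal 0 1) (Iic 0)).toReal = 1 := by
    have := congrArg ENNReal.toReal hunion
    rw [ENNReal.toReal_add hne hne, ENNReal.toReal_one] at this
    linarith
  rw [measureReal_def]
  linarith

/-- **Shift**: `N(δ,1)([−z, z]) = N(0,1)([−z−δ, z−δ])`. [folklore] -/
theorem gaussianReal_real_Icc_shift (δ z : ℝ) :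
    (gaussianReal δ 1).real (Icc (-z) z) = (gaussianReal 0 1).real (Icc (-z - δ) (z - δ)) := by
  have h := gaussianReal_map_add_const (μ := 0) (v := 1) δ
  rw [zero_add] at h
  rw [measureReal_def, measureReal_def, ← h,
    Measure.map_apply (measurable_add_const δ) measurableSet_Icc]
  congr 2
  ext x
  simp only [mem_preimage, mem_Icc]
  constructor <;> rintro ⟨h1, h2⟩ <;> constructor <;> linarith

/-- **A discrepancy of exactly `z` true combined standard errors passes "within `z·σ_comb`" with
probability at most `1/2`**: `N(z,1)([−z, z]) ≤ 1/2` (`z` arbitrary). [ours] -/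
theorem gaussianReal_real_Icc_self_le_half (z : ℝ) :
    (gaussianReal z 1).real (Icc (-z) z) ≤ 1 / 2 := by
  rw [gaussianReal_real_Icc_shift, sub_self, ← gaussianReal_real_Iic_zero]
  exact measureReal_mono Icc_subset_Iic_self

/-- **The window probability vanishes for large positive discrepancies**:
`N(δ,1)([−z, z]) → 0` as `δ → +∞`. [ours] -/
theorem tendsto_gaussianReal_real_Icc_atTop (z : ℝ) :
    Tendsto (fun δ : ℝ => (gaussianReal δ 1).real (Icc (-z) z)) atTop (𝓝 0) := by
  have hcdf : Tendsto (fun δ : ℝ => cdf (gaussianReal 0 1) (z - δ)) atTop (𝓝 0) :=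
    (tendsto_cdf_atBot (gaussianReal 0 1)).comp
      (tendsto_atBot_add_const_left _ z (tendsto_neg_atTop_atBot))
  refine tendsto_of_tendsto_of_tendsto_of_le_of_le' tendsto_const_nhds hcdf
    (Eventually.of_forall fun δ => measureReal_nonneg) (Eventually.of_forall fun δ => ?_)
  rw [gaussianReal_real_Icc_shift, cdf_eq_real]
  exact measureReal_mono Icc_subset_Iic_self

/-- **… and for large negative discrepancies**: `N(δ,1)([−z, z]) → 0` as `δ → −∞`. [ours] -/
theorem tendsto_gaussianReal_real_Icc_atBot (z : ℝ) :
    Tendsto (fun δ : ℝ => (gaussianReal δ 1).real (Icc (-z) z)) atBot (𝓝 0) := by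
  -- reflect: `N(δ,1)([−z, z]) = N(−δ,1)([−z, z])`
  have hrefl : ∀ δ : ℝ, (gaussianReal δ 1).real (Icc (-z) z)
      = (gaussianReal (-δ) 1).real (Icc (-z) z) := fun δ => by
    have h := gaussianReal_map_neg (μ := δ) (v := 1)
    rw [measureReal_def, measureReal_def, ← h, Measure.map_apply measurable_neg measurableSet_Icc]
    congr 2
    ext x
    simp only [mem_preimage, mem_Icc]
    constructor <;> rintro ⟨h1, h2⟩ <;> constructor <;> linarith
  have hcomp : (fun δ : ℝ => (gaussianReal δ 1).real (Icc (-z) z))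
      = (fun δ : ℝ => (gaussianReal δ 1).real (Icc (-z) z)) ∘ (fun δ : ℝ => -δ) := by
    funext δ
    exact hrefl δ
  rw [hcomp]
  exact (tendsto_gaussianReal_real_Icc_atTop z).comp tendsto_neg_atBot_atTop

end Gaussian

/-! ## §2 The studentised difference under local alternatives -/

section LocalPower

variable {ΩA : Type*} [MeasurableSpace ΩA] {PA : Measure ΩA} [IsProbabilityMeasure PA]
variable {ΩB : Type*} [MeasurableSpace ΩB] {PB : Measure ΩB} [IsProbabilityMeasure PB]
variable {Ω' : Type*} [MeasurableSpace Ω'] {P' : Measure Ω'} [IsProbabilityMeasure P']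

/-- **THE STUDENTISED DIFFERENCE UNDER LOCAL ALTERNATIVES.**  Two independent codes print
measurable columns `Sₙ^A`, `Sₙ^B` and non-degenerate squared standard errors: `√n (Sₙ^A − a) ⇒
N(0, s_A)`, `√n (Sₙ^B − bₙ) ⇒ N(0, s_B)` (moving target `bₙ`), `n·V̂ₙ^A → s_A > 0`,
`n·V̂ₙ^B → s_B > 0` in probability; code `B` is read along any `mₙ → ∞`.  If the discrepancy in
true combined standard errors converges, `(a − b_{mₙ})/√(s_A/n + s_B/mₙ) → δ`, then for
`Z ∼ N(0,1)`: `(Sₙ^A − S_{mₙ}^B)/√(V̂ₙ^A + V̂_{mₙ}^B) ⇒ Z + δ` on `P_A ⊗ P_B`. [ours] -/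
theorem twoSample_agreement_local_clt {SA VA : ℕ → ΩA → ℝ} {SB VB : ℕ → ΩB → ℝ}
    {a sA sB δ : ℝ} {b : ℕ → ℝ} {ZA ZB Z : Ω' → ℝ} (hsA : 0 < sA) (hsB : 0 < sB)
    (hSAm : ∀ n, Measurable (SA n)) (hVAm : ∀ n, Measurable (VA n))
    (hSBm : ∀ n, Measurable (SB n)) (hVBm : ∀ n, Measurable (VB n))
    (hcltA : TendstoInDistribution (fun (n : ℕ) ω => Real.sqrt n * (SA n ω - a)) atTop ZA
      (fun _ => PA) P') (hZA : HasLaw ZA (gaussianReal 0 sA.toNNReal) P')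
    (hcltB : TendstoInDistribution (fun (n : ℕ) ω => Real.sqrt n * (SB n ω - b n)) atTop ZB
      (fun _ => PB) P') (hZB : HasLaw ZB (gaussianReal 0 sB.toNNReal) P')
    (hVA : TendstoInMeasure PA (fun (n : ℕ) ω => (n : ℝ) * VA n ω) atTop fun _ => sA)
    (hVB : TendstoInMeasure PB (fun (n : ℕ) ω => (n : ℝ) * VB n ω) atTop fun _ => sB)
    {m : ℕ → ℕ} (hm : Tendsto m atTop atTop)
    (hδ : Tendsto (fun n : ℕ => (a - b (m n)) / Real.sqrt (sA / n + sB / (m n))) atTop (𝓝 δ))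
    (hZ : HasLaw Z (gaussianReal 0 1) P') :
    TendstoInDistribution (fun (n : ℕ) (ω : ΩA × ΩB) =>
        (SA n ω.1 - SB (m n) ω.2) / Real.sqrt (VA n ω.1 + VB (m n) ω.2))
      atTop (fun ω => Z ω + δ) (fun _ => PA.prod PB) P' := by
  -- Step 1: recentre code `B` at `a`; the null theorem gives `T''ₙ ⇒ Z`
  set SB' : ℕ → ΩB → ℝ := fun k ω => SB k ω - b k + a with hSB'
  have hSB'm : ∀ n, Measurable (SB' n) := fun n => ((hSBm n).sub_const _).add_const _
  have hcltB' : TendstoInDistribution (fun (n : ℕ) ω => Real.sqrt n * (SB' n ω - a)) atTop ZB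
      (fun _ => PB) P' := by
    refine hcltB.congr (fun n => Eventually.of_forall fun ω => ?_) EventuallyEq.rfl
    simp only [hSB']
    ring
  have hT'' := twoSample_agreement_clt_of_tendstoInMeasure hsA hsB hSAm hVAm hSB'm hVBm hcltA hZA
    hcltB' hZB hVA hVB hm hZ
  -- Step 2: the pooled-variance ratio `ρₙ → 1` in probability on the product space
  have hA' : TendstoInMeasure (PA.prod PB) (fun (n : ℕ) (ω : ΩA × ΩB) => (n : ℝ) * VA n ω.1)
      atTop fun _ => sA :=
    tendstoInMeasure_comp_fst hVA
  have hB' : TendstoInMeasure (PA.prod PB)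
      (fun (n : ℕ) (ω : ΩA × ΩB) => ((m n : ℕ) : ℝ) * VB (m n) ω.2) atTop fun _ => sB :=
    tendstoInMeasure_comp_snd (tendstoInMeasure_comp_tendsto hVB hm)
  have hpq : ∀ᶠ n : ℕ in atTop, 0 ≤ (n : ℝ)⁻¹ ∧ 0 ≤ ((m n : ℕ) : ℝ)⁻¹
      ∧ 0 < (n : ℝ)⁻¹ + ((m n : ℕ) : ℝ)⁻¹ := by
    filter_upwards [eventually_ge_atTop 1] with n hn
    have hn0 : (0 : ℝ) < n := by exact_mod_cast hn
    exact ⟨(inv_pos.2 hn0).le, inv_nonneg.2 (Nat.cast_nonneg _),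
      add_pos_of_pos_of_nonneg (inv_pos.2 hn0) (inv_nonneg.2 (Nat.cast_nonneg _))⟩
  have hρ : TendstoInMeasure (PA.prod PB) (fun (n : ℕ) (ω : ΩA × ΩB) =>
      ((n : ℝ) * VA n ω.1 * (n : ℝ)⁻¹ + ((m n : ℕ) : ℝ) * VB (m n) ω.2 * ((m n : ℕ) : ℝ)⁻¹)
        / (sA * (n : ℝ)⁻¹ + sB * ((m n : ℕ) : ℝ)⁻¹)) atTop fun _ => (1 : ℝ) :=
    tendstoInMeasure_weightedRatio_one hsA hsB hA' hB' hpq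
  -- Step 3: `(√ρₙ)⁻¹ → 1` and the deterministic `δₙ → δ`, so the shift `Dₙ = δₙ (√ρₙ)⁻¹ → δ`
  have hφ : ContinuousAt (fun r : ℝ => (Real.sqrt r)⁻¹) 1 := by
    refine ContinuousAt.inv₀ Real.continuous_sqrt.continuousAt ?_
    rw [Real.sqrt_one]; exact one_ne_zero
  have hinv := tendstoInMeasure_comp_continuousAt hρ hφ
  rw [Real.sqrt_one, inv_one] at hinv
  have hδ' : TendstoInMeasure (PA.prod PB)
      (fun (n : ℕ) (_ : ΩA × ΩB) => (a - b (m n)) / Real.sqrt (sA / n + sB / (m n))) atTop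
      fun _ => δ :=
    tendstoInMeasure_of_tendsto_ae (fun n => aestronglyMeasurable_const)
      (Eventually.of_forall fun _ => hδ)
  have hpair := tendstoInMeasure_prodMk hδ' hinv
  have hmul : ContinuousAt (fun p : ℝ × ℝ => p.1 * p.2) (δ, 1) := by fun_prop
  have hD := tendstoInMeasure_comp_continuousAt_normed hpair hmul
  simp only [mul_one] at hD
  -- the shift `Dₙ = (a − b_{mₙ})/√(V̂ₙ^A + V̂_{mₙ}^B)` equals `δₙ (√ρₙ)⁻¹` once `n, mₙ ≥ 1`
  have hD' : TendstoInMeasure (PA.prod PB) (fun (n : ℕ) (ω : ΩA × ΩB) =>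
      (a - b (m n)) / Real.sqrt (VA n ω.1 + VB (m n) ω.2)) atTop fun _ => δ := by
    refine hD.congr' ?_ EventuallyEq.rfl
    filter_upwards [eventually_ge_atTop 1, hm.eventually (eventually_ge_atTop 1)] with n hn1 hm1
    refine Eventually.of_forall fun ω => ?_
    have hn0 : (n : ℝ) ≠ 0 := Nat.cast_ne_zero.2 (by omega)
    have hm0 : ((m n : ℕ) : ℝ) ≠ 0 := Nat.cast_ne_zero.2 (by omega)
    have hden : 0 < sA * (n : ℝ)⁻¹ + sB * ((m n : ℕ) : ℝ)⁻¹ :=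
      add_pos (mul_pos hsA (inv_pos.2 (Nat.cast_pos.2 (by omega))))
        (mul_pos hsB (inv_pos.2 (Nat.cast_pos.2 (by omega))))
    have hV : VA n ω.1 + VB (m n) ω.2
        = ((n : ℝ) * VA n ω.1 * (n : ℝ)⁻¹ + ((m n : ℕ) : ℝ) * VB (m n) ω.2 * ((m n : ℕ) : ℝ)⁻¹)
          / (sA * (n : ℝ)⁻¹ + sB * ((m n : ℕ) : ℝ)⁻¹) * (sA / n + sB / (m n)) := by
      field_simp
    show (a - b (m n)) / Real.sqrt (sA / n + sB / (m n)) * (Real.sqrt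
        (((n : ℝ) * VA n ω.1 * (n : ℝ)⁻¹ + ((m n : ℕ) : ℝ) * VB (m n) ω.2 * ((m n : ℕ) : ℝ)⁻¹)
          / (sA * (n : ℝ)⁻¹ + sB * ((m n : ℕ) : ℝ)⁻¹)))⁻¹
      = (a - b (m n)) / Real.sqrt (VA n ω.1 + VB (m n) ω.2)
    rw [hV, Real.sqrt_mul' _ (by positivity)]
    have hs : Real.sqrt (sA / n + sB / (m n)) ≠ 0 :=
      (Real.sqrt_pos.2 (by positivity)).ne'
    field_simp
  have hDm : ∀ n : ℕ, AEMeasurable (fun ω : ΩA × ΩB =>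
      (a - b (m n)) / Real.sqrt (VA n ω.1 + VB (m n) ω.2)) (PA.prod PB) := fun n =>
    (measurable_const.div
      (((hVAm n).comp measurable_fst).add ((hVBm (m n)).comp measurable_snd)).sqrt).aemeasurable
  -- Step 4: Slutsky, `Tₙ = T''ₙ + Dₙ`
  have hsum := hT''.add_of_tendstoInMeasure_const hD' hDm
  refine hsum.congr (fun n => Eventually.of_forall fun ω => ?_) EventuallyEq.rfl
  simp only [hSB', Pi.add_apply]
  rw [← add_div]
  ring

/-- **THE POWER FUNCTION OF "A VS B WITHIN `z·σ_comb`".**  In the setting of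
`twoSample_agreement_local_clt` (discrepancy `→ δ` true combined standard errors), for every `z`:
`(P_A ⊗ P_B)(|Tₙ| ≤ z) → N(δ, 1)([−z, z])` — the criterion's asymptotic pass probability; its
complement is the power.  (`δ = 0`: nominal coverage; `δ = z`: at most `1/2`,
`gaussianReal_real_Icc_self_le_half`; `δ → ±∞`: `→ 0`, `tendsto_gaussianReal_real_Icc_atTop/Bot`.)
[ours] -/
theorem twoSample_agreement_localPower {SA VA : ℕ → ΩA → ℝ} {SB VB : ℕ → ΩB → ℝ}
    {a sA sB δ : ℝ} {b : ℕ → ℝ} {ZA ZB Z : Ω' → ℝ} (hsA : 0 < sA) (hsB : 0 < sB)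
    (hSAm : ∀ n, Measurable (SA n)) (hVAm : ∀ n, Measurable (VA n))
    (hSBm : ∀ n, Measurable (SB n)) (hVBm : ∀ n, Measurable (VB n))
    (hcltA : TendstoInDistribution (fun (n : ℕ) ω => Real.sqrt n * (SA n ω - a)) atTop ZA
      (fun _ => PA) P') (hZA : HasLaw ZA (gaussianReal 0 sA.toNNReal) P')
    (hcltB : TendstoInDistribution (fun (n : ℕ) ω => Real.sqrt n * (SB n ω - b n)) atTop ZB
      (fun _ => PB) P') (hZB : HasLaw ZB (gaussianReal 0 sB.toNNReal) P')
    (hVA : TendstoInMeasure PA (fun (n : ℕ) ω => (n : ℝ) * VA n ω) atTop fun _ => sA)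
    (hVB : TendstoInMeasure PB (fun (n : ℕ) ω => (n : ℝ) * VB n ω) atTop fun _ => sB)
    {m : ℕ → ℕ} (hm : Tendsto m atTop atTop)
    (hδ : Tendsto (fun n : ℕ => (a - b (m n)) / Real.sqrt (sA / n + sB / (m n))) atTop (𝓝 δ))
    (hZ : HasLaw Z (gaussianReal 0 1) P') (z : ℝ) :
    Tendsto (fun n => (PA.prod PB).real {ω : ΩA × ΩB |
        |(SA n ω.1 - SB (m n) ω.2) / Real.sqrt (VA n ω.1 + VB (m n) ω.2)| ≤ z}) atTop
      (𝓝 ((gaussianReal δ 1).real (Icc (-z) z))) := by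
  have h := twoSample_agreement_local_clt hsA hsB hSAm hVAm hSBm hVBm hcltA hZA hcltB hZB hVA hVB
    hm hδ hZ
  have hZδ : HasLaw (fun ω => Z ω + δ) (gaussianReal δ 1) P' := by
    have := gaussianReal_add_const hZ δ
    rwa [zero_add] at this
  haveI : NullSingletonClass (P'.map fun ω => Z ω + δ) := by
    rw [hZδ.map_eq]
    exact nullSingletonClass_gaussianReal one_ne_zero
  have key := tendsto_measureReal_abs_le_of_tendstoInDistribution h z
  have e : P'.real {ω' | |Z ω' + δ| ≤ z} = (gaussianReal δ 1).real (Icc (-z) z) := by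
    rw [← hZδ.map_eq, measureReal_def, measureReal_def,
      Measure.map_apply_of_aemeasurable hZδ.aemeasurable measurableSet_Icc]
    congr 1
    congr 1
    ext ω'
    simp [abs_le]
  rw [e] at key
  exact key

end LocalPower

end Summit.Ventures.LatticeQCDFlow.Scoring.CardConsistency

end
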